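import Summits.RiemannHypothesis.RiemannHypothesis.Theorems.PfPersistenceArithDialSpace
import HarnessLib

/-!
# PF persistence — the MIRROR WINDOW of a dial, and inertia readers versus heavy dials (pub-rhpf, cand-6 gen 3)

**HONEST FRAMING. This is a long-odds MECHANISM SEARCH; no RH claims.** Every statement below is RH-free
bookkeeping about the cell's observatory records (truncated Weil matrices of weight tables); nothing here bears
on the truth of RH. Labels: PROVED = kernel-checked here or in the imported tree files.

* §1 MIRROR WINDOW IDENTITY (PROVED `thetaEven_two_mul_self`): on the support of length `L = 2y` the Connes–Consani
  test matrix at the shift `y` is DIAGONAL with alternating signs, `θ_{nm}^{(2y)}(y) = δ_{nm} (−1)^n / 2`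
  (generalises `thetaEven_one_one_self`). Hence at the window `a = log p` (any `N`) the prime pattern of `p` is
  `diag((−1)^n / 2)` and a dial `K` at `p` acts as `Q ↦ Q − (K − 1) w(p) · diag((−1)^n)` (`evenBlock_dial_mirror`):
  it pushes the even-indexed modes DOWN and the odd-indexed modes UP (or vice versa).
* §2 TWO-PLANE NEGATIVITY (PROVED): past an explicit threshold, an UP-dial (`(K−1) w(p)` large) makes the block —
  minus ANY fixed offset matrix `M₀` (e.g. `0`, or the polar block for pole-free readers) — negative definite on the
  plane of two even-indexed modes; a sign-reversed dial does the same on two odd-indexed modes.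
* §3 INERTIA READERS REJECT HEAVY DIALS (PROVED `heavyDial_negative_not_mem_of_hyperplanePositive`): a class whose
  members are, at every window, positive semidefinite on SOME hyperplane after subtracting `M₀` ("at most one
  negative direction": `E₁(A₀) ≥ 0` for `M₀ = polar`, `ε₂ ≥ 0` for `M₀ = 0` — leaves G1.08 / G1.09 / G1.21c) contains
  NO sufficiently heavy prime dial of `ζ` of either sign (`N ≥ 3` at the mirror window), although those dials are
  arithmetic and detectably negative. So the heavy-dial witnesses behind wall W1 / the co-convex and fibrewise
  barriers can never close an inertia reader: such readers are immune to that witness family BY THEOREM, and their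
  status rests on small dials (DATA, `DialReady`-type inputs) — consistent with the cell's designation of the inertia
  leaves as the place "where the arithmetic enters". This is a SOUNDNESS statement about a reader class on one
  witness family, not a closure and not a separation claim.
-/

set_option linter.dupNamespace false  -- the mandated namespace repeats `RiemannHypothesis`

noncomputable section

open Real Finset Matrix

namespace Summit.RiemannHypothesis.RiemannHypothesis.Theorems.PfPersistence

/-! ## §1 The mirror window identity -/

/-- **PROVED — MIRROR WINDOW IDENTITY:** `θ_{nm}^{(2y)}(y) = δ_{nm} (−1)^n / 2` (`sin nπ = 0`, `cos nπ = (−1)^n`). [folklore] -/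
theorem thetaEven_two_mul_self {y : ℝ} (hy : y ≠ 0) (n m : ℕ) :
    thetaEven (2 * y) n m y = if n = m then (-1 : ℝ) ^ n / 2 else 0 := by
  have harg : ∀ k : ℕ, 2 * π * (k : ℝ) * y / (2 * y) = (k : ℝ) * π := fun k => by
    field_simp
  have hsin : ∀ k : ℕ, Real.sin (2 * π * (k : ℝ) * y / (2 * y)) = 0 := fun k => by
    rw [harg, Real.sin_nat_mul_pi]
  have hcos : ∀ k : ℕ, Real.cos (2 * π * (k : ℝ) * y / (2 * y)) = (-1) ^ k := fun k => by
    rw [harg, Real.cos_nat_mul_pi]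
  have hhalf : (2 * y - y) / (2 * y) = 1 / 2 := by
    field_simp
    ring
  unfold thetaEven
  by_cases hn : n = 0
  · subst hn
    by_cases hm : m = 0
    · subst hm
      simp [hhalf]
    · rw [if_neg (by simp [hm]), if_pos rfl, hsin, if_neg (Ne.symm hm)]
      simp
  · by_cases hm : m = 0
    · subst hm
      rw [if_neg (by simp [hn]), if_neg hn, if_pos rfl, hsin, if_neg hn]
      simp
    · rw [if_neg (by simp [hn]), if_neg hn, if_neg hm]
      by_cases hnm : n = m
      · subst hnm
        rw [if_pos rfl, if_pos rfl, hhalf, hcos, hsin]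
        ring
      · rw [if_neg hnm, if_neg hnm, hsin, hsin]
        simp

/-- PROVED: at the mirror window `a = log p` the prime pattern of `p` is `diag((−1)^n / 2)`. [folklore] -/
theorem primePattern_mirror {p : ℕ} (hp : 2 ≤ p) {win : Window} (hwin : win.a = Real.log p) :
    primePattern p win = Matrix.diagonal fun n : Fin (win.N + 1) => (-1 : ℝ) ^ (n : ℕ) / 2 := by
  have hy : Real.log p ≠ 0 := (Real.log_pos (by exact_mod_cast (by omega : 1 < p))).ne'
  ext n m
  show thetaEven (2 * win.a) n m (Real.log p) = _
  rw [hwin, thetaEven_two_mul_self hy, Matrix.diagonal_apply]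
  by_cases h : n = m
  · subst h
    rw [if_pos rfl, if_pos rfl]
  · rw [if_neg fun h' => h (Fin.ext h'), if_neg h]

/-- **PROVED — a dial at its mirror window acts diagonally with alternating signs:**
`Q(dial p K w)(log p, N) = Q(w)(log p, N) − (K − 1) w(p) · diag((−1)^n)`. [folklore] -/
theorem evenBlock_dial_mirror {p : ℕ} (hp : 2 ≤ p) {win : Window} (hwin : win.a = Real.log p) (K : ℝ)
    (w : Weights) :
    evenBlock (dial p K w) win =
      evenBlock w win - ((K - 1) * w p) • Matrix.diagonal fun n : Fin (win.N + 1) => (-1 : ℝ) ^ (n : ℕ) := by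
  have hlogp : 0 < Real.log p := Real.log_pos (by exact_mod_cast (by omega : 1 < p))
  have hmem : p ∈ primeRange (2 * win.a) := by
    apply mem_primeRange_of_log_le
    rw [hwin]
    linarith
  rw [evenBlock_dial_eq hmem, primePattern_mirror hp hwin]
  ext n m
  simp only [Matrix.sub_apply, Matrix.smul_apply, Matrix.diagonal_apply, smul_eq_mul]
  split_ifs <;> ring

/-! ## §2 Two-plane negativity past an explicit threshold -/

/-- PROVED: the form between two scaled basis vectors is the matrix entry. [folklore] -/
theorem single_form_single {n : ℕ} (M : Matrix (Fin n) (Fin n) ℝ) (i j : Fin n) (s t : ℝ) :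
    (Pi.single i s : Fin n → ℝ) ⬝ᵥ (M *ᵥ Pi.single j t) = s * M i j * t := by
  rw [single_dotProduct]
  simp only [Matrix.mulVec, dotProduct_single]
  ring

/-- PROVED: the form on the plane of two basis vectors. [folklore] -/
theorem plane_form {n : ℕ} (M : Matrix (Fin n) (Fin n) ℝ) (i j : Fin n) (s t : ℝ) :
    (Pi.single i s + Pi.single j t : Fin n → ℝ) ⬝ᵥ (M *ᵥ (Pi.single i s + Pi.single j t)) =
      s * M i i * s + s * M i j * t + t * M j i * s + t * M j j * t := by
  rw [Matrix.mulVec_add, dotProduct_add, add_dotProduct, add_dotProduct, single_form_single,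
    single_form_single, single_form_single, single_form_single]
  ring

/-- PROVED: crude bound of the plane form by the four entries. [folklore] -/
theorem plane_form_le {n : ℕ} (M : Matrix (Fin n) (Fin n) ℝ) (i j : Fin n) (s t : ℝ) :
    s * M i i * s + s * M i j * t + t * M j i * s + t * M j j * t ≤
      (|M i i| + |M i j| + |M j i| + |M j j|) * (s * s + t * t) := by
  have hcross : ∀ b : ℝ, s * b * t ≤ |b| * (s * s + t * t) := by
    intro b
    have h1 : s * b * t ≤ |s * b * t| := le_abs_self _
    have h2 : |s * b * t| = |s| * |t| * |b| := by
      rw [abs_mul, abs_mul]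
      ring
    have h3 : |s| * |t| ≤ s * s + t * t := by
      nlinarith [two_mul_le_add_sq (|s|) (|t|), abs_mul_abs_self s, abs_mul_abs_self t, abs_nonneg s,
        abs_nonneg t]
    nlinarith [abs_nonneg b]
  have hdiag : ∀ b r : ℝ, r * b * r ≤ |b| * (s * s + t * t) → True := fun _ _ _ => trivial
  have hd1 : s * M i i * s ≤ |M i i| * (s * s + t * t) := by
    nlinarith [le_abs_self (M i i), abs_nonneg (M i i), mul_self_nonneg s, mul_self_nonneg t]
  have hd2 : t * M j j * t ≤ |M j j| * (s * s + t * t) := by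
    nlinarith [le_abs_self (M j j), abs_nonneg (M j j), mul_self_nonneg s, mul_self_nonneg t]
  have hc1 := hcross (M i j)
  have hc2 : t * M j i * s ≤ |M j i| * (s * s + t * t) := by
    have := hcross (M j i)
    linarith
  linarith

/-- PROVED: two distinct non-zero coefficients are not both zero ⇒ `s² + t² > 0`. [folklore] -/
theorem sq_add_sq_pos_of_ne {s t : ℝ} (hst : s ≠ 0 ∨ t ≠ 0) : 0 < s * s + t * t := by
  rcases hst with h | h
  · have := mul_self_pos.2 h
    nlinarith [mul_self_nonneg t]
  · have := mul_self_pos.2 h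
    nlinarith [mul_self_nonneg s]

/-- **PROVED — UP-dials are negative definite on a plane of two even modes (minus any offset `M₀`).** At the mirror
window, if `(K − 1) w(p)` exceeds the four relevant entries of `Q(w) − M₀` in absolute value plus one, then
`Q(dial p K w) − M₀` is negative on every non-zero vector of the plane of two distinct even-indexed modes. [folklore] -/
theorem mirror_plane_neg_up {p : ℕ} (hp : 2 ≤ p) {win : Window} (hwin : win.a = Real.log p) (w : Weights)
    (M₀ : Matrix (Fin (win.N + 1)) (Fin (win.N + 1)) ℝ) {i j : Fin (win.N + 1)} (hij : i ≠ j)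
    (hi : Even (i : ℕ)) (hj : Even (j : ℕ)) {K : ℝ}
    (hK : |(evenBlock w win - M₀) i i| + |(evenBlock w win - M₀) i j| + |(evenBlock w win - M₀) j i| +
        |(evenBlock w win - M₀) j j| + 1 ≤ (K - 1) * w p)
    {s t : ℝ} (hst : s ≠ 0 ∨ t ≠ 0) :
    (Pi.single i s + Pi.single j t : Fin (win.N + 1) → ℝ) ⬝ᵥ
      ((evenBlock (dial p K w) win - M₀) *ᵥ (Pi.single i s + Pi.single j t)) < 0 := by
  have hre : evenBlock (dial p K w) win - M₀ =
      (evenBlock w win - M₀) - ((K - 1) * w p) • Matrix.diagonal fun n : Fin (win.N + 1) => (-1 : ℝ) ^ (n : ℕ) := by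
    rw [evenBlock_dial_mirror hp hwin, sub_right_comm]
  rw [hre, rayleigh_sub_smul, plane_form, plane_form]
  have hDii : (Matrix.diagonal fun n : Fin (win.N + 1) => (-1 : ℝ) ^ (n : ℕ)) i i = 1 := by
    rw [Matrix.diagonal_apply_eq, hi.neg_one_pow]
  have hDjj : (Matrix.diagonal fun n : Fin (win.N + 1) => (-1 : ℝ) ^ (n : ℕ)) j j = 1 := by
    rw [Matrix.diagonal_apply_eq, hj.neg_one_pow]
  have hDij : (Matrix.diagonal fun n : Fin (win.N + 1) => (-1 : ℝ) ^ (n : ℕ)) i j = 0 :=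
    Matrix.diagonal_apply_ne _ hij
  have hDji : (Matrix.diagonal fun n : Fin (win.N + 1) => (-1 : ℝ) ^ (n : ℕ)) j i = 0 :=
    Matrix.diagonal_apply_ne _ (Ne.symm hij)
  rw [hDii, hDjj, hDij, hDji]
  have hB := plane_form_le (evenBlock w win - M₀) i j s t
  have hpos := sq_add_sq_pos_of_ne hst
  nlinarith

/-- **PROVED — sign-reversed dials are negative definite on a plane of two odd modes (minus any offset `M₀`).** [folklore] -/
theorem mirror_plane_neg_down {p : ℕ} (hp : 2 ≤ p) {win : Window} (hwin : win.a = Real.log p) (w : Weights)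
    (M₀ : Matrix (Fin (win.N + 1)) (Fin (win.N + 1)) ℝ) {i j : Fin (win.N + 1)} (hij : i ≠ j)
    (hi : Odd (i : ℕ)) (hj : Odd (j : ℕ)) {K : ℝ}
    (hK : |(evenBlock w win - M₀) i i| + |(evenBlock w win - M₀) i j| + |(evenBlock w win - M₀) j i| +
        |(evenBlock w win - M₀) j j| + 1 ≤ (1 - K) * w p)
    {s t : ℝ} (hst : s ≠ 0 ∨ t ≠ 0) :
    (Pi.single i s + Pi.single j t : Fin (win.N + 1) → ℝ) ⬝ᵥ
      ((evenBlock (dial p K w) win - M₀) *ᵥ (Pi.single i s + Pi.single j t)) < 0 := by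
  have hre : evenBlock (dial p K w) win - M₀ =
      (evenBlock w win - M₀) - ((K - 1) * w p) • Matrix.diagonal fun n : Fin (win.N + 1) => (-1 : ℝ) ^ (n : ℕ) := by
    rw [evenBlock_dial_mirror hp hwin, sub_right_comm]
  rw [hre, rayleigh_sub_smul, plane_form, plane_form]
  have hDii : (Matrix.diagonal fun n : Fin (win.N + 1) => (-1 : ℝ) ^ (n : ℕ)) i i = -1 := by
    rw [Matrix.diagonal_apply_eq, hi.neg_one_pow]
  have hDjj : (Matrix.diagonal fun n : Fin (win.N + 1) => (-1 : ℝ) ^ (n : ℕ)) j j = -1 := by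
    rw [Matrix.diagonal_apply_eq, hj.neg_one_pow]
  have hDij : (Matrix.diagonal fun n : Fin (win.N + 1) => (-1 : ℝ) ^ (n : ℕ)) i j = 0 :=
    Matrix.diagonal_apply_ne _ hij
  have hDji : (Matrix.diagonal fun n : Fin (win.N + 1) => (-1 : ℝ) ^ (n : ℕ)) j i = 0 :=
    Matrix.diagonal_apply_ne _ (Ne.symm hij)
  rw [hDii, hDjj, hDij, hDji]
  have hB := plane_form_le (evenBlock w win - M₀) i j s t
  have hpos := sq_add_sq_pos_of_ne hst
  nlinarith

/-- PROVED: a plane that is negative (minus `M₀`) meets every hyperplane — no hyperplane is positive. [folklore] -/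
theorem exists_orth_neg_of_plane_neg {n : ℕ} (M : Matrix (Fin n) (Fin n) ℝ) (i j : Fin n)
    (hplane : ∀ s t : ℝ, (s ≠ 0 ∨ t ≠ 0) →
      (Pi.single i s + Pi.single j t : Fin n → ℝ) ⬝ᵥ (M *ᵥ (Pi.single i s + Pi.single j t)) < 0)
    (u : Fin n → ℝ) : ∃ v : Fin n → ℝ, v ⬝ᵥ u = 0 ∧ v ⬝ᵥ (M *ᵥ v) < 0 := by
  by_cases hu : u i = 0 ∧ u j = 0
  · refine ⟨Pi.single i 1 + Pi.single j 0, ?_, hplane 1 0 (Or.inl one_ne_zero)⟩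
    rw [add_dotProduct, single_dotProduct, single_dotProduct, hu.1]
    ring
  · refine ⟨Pi.single i (u j) + Pi.single j (-u i), ?_, hplane (u j) (-u i) ?_⟩
    · rw [add_dotProduct, single_dotProduct, single_dotProduct]
      ring
    · by_cases hj : u j = 0
      · right
        intro h
        exact hu ⟨neg_eq_zero.1 h, hj⟩
      · exact Or.inl hj

/-! ## §3 Inertia readers reject heavy dials -/

/-- **PROVED — "AT MOST ONE NEGATIVE DIRECTION" READERS CONTAIN NO HEAVY PRIME DIAL OF `ζ`.** Fix offsets `M₀`
(one matrix per window: `0` for `ε₂ ≥ 0`-type readers, the polar block for pole-free `E₁(A₀) ≥ 0`-type readers) and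
a class `S` each of whose members is, at EVERY window, positive semidefinite on some hyperplane after subtracting
`M₀`. Then for every prime `p` and every mirror window `(log p, N)` with `N ≥ 3` there is a threshold `C > 0` such
that every dial `K` at `p` with `|K − 1| ≥ C` gives an ARITHMETIC, DETECTABLY NEGATIVE datum that is NOT in `S`.
The heavy-dial witness family of wall W1 therefore never closes such a reader. [folklore] -/
theorem heavyDial_negative_not_mem_of_hyperplanePositive {S : Set Datum}
    (M₀ : (win : Window) → Matrix (Fin (win.N + 1)) (Fin (win.N + 1)) ℝ)
    (hS : S ⊆ {d | ∀ win : Window, ∃ u : Fin (win.N + 1) → ℝ,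
      ∀ v : Fin (win.N + 1) → ℝ, v ⬝ᵥ u = 0 → 0 ≤ v ⬝ᵥ ((d win - M₀ win) *ᵥ v)})
    {p : ℕ} (hp : p.Prime) {win : Window} (hwin : win.a = Real.log p) (hN : 3 ≤ win.N) :
    ∃ C : ℝ, 0 < C ∧ ∀ K : ℝ, C ≤ |K - 1| →
      datumOf (dial p K zetaWeights) ∈ arithDialSpace ∧ DetectablyNegative (datumOf (dial p K zetaWeights)) ∧
        datumOf (dial p K zetaWeights) ∉ S := by
  have hp2 : 2 ≤ p := hp.two_le
  have hwp : 0 < zetaWeights p := zetaWeights_pos_of_prime hp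
  -- the four modes: `0, 2` (even) and `1, 3` (odd)
  obtain ⟨i₀, hi₀⟩ : ∃ i : Fin (win.N + 1), (i : ℕ) = 0 := ⟨⟨0, by omega⟩, rfl⟩
  obtain ⟨i₁, hi₁⟩ : ∃ i : Fin (win.N + 1), (i : ℕ) = 1 := ⟨⟨1, by omega⟩, rfl⟩
  obtain ⟨i₂, hi₂⟩ : ∃ i : Fin (win.N + 1), (i : ℕ) = 2 := ⟨⟨2, by omega⟩, rfl⟩
  obtain ⟨i₃, hi₃⟩ : ∃ i : Fin (win.N + 1), (i : ℕ) = 3 := ⟨⟨3, by omega⟩, rfl⟩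
  have h02 : i₀ ≠ i₂ := fun h => by have := congrArg Fin.val h; omega
  have h13 : i₁ ≠ i₃ := fun h => by have := congrArg Fin.val h; omega
  have he₀ : Even (i₀ : ℕ) := by rw [hi₀]; exact ⟨0, rfl⟩
  have he₂ : Even (i₂ : ℕ) := by rw [hi₂]; exact ⟨1, rfl⟩
  have ho₁ : Odd (i₁ : ℕ) := by rw [hi₁]; exact ⟨0, rfl⟩
  have ho₃ : Odd (i₃ : ℕ) := by rw [hi₃]; exact ⟨1, rfl⟩
  -- thresholds: with the offset `M₀ win` (membership) and with offset `0` (negativity)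
  obtain ⟨B, hB⟩ : ∃ B : Matrix (Fin (win.N + 1)) (Fin (win.N + 1)) ℝ, B = evenBlock zetaWeights win - M₀ win :=
    ⟨_, rfl⟩
  obtain ⟨Z, hZ⟩ : ∃ Z : Matrix (Fin (win.N + 1)) (Fin (win.N + 1)) ℝ, Z = evenBlock zetaWeights win - 0 :=
    ⟨_, rfl⟩
  obtain ⟨cU, hcU⟩ : ∃ c : ℝ, c = |B i₀ i₀| + |B i₀ i₂| + |B i₂ i₀| + |B i₂ i₂| + 1 := ⟨_, rfl⟩
  obtain ⟨cD, hcD⟩ : ∃ c : ℝ, c = |B i₁ i₁| + |B i₁ i₃| + |B i₃ i₁| + |B i₃ i₃| + 1 := ⟨_, rfl⟩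
  obtain ⟨zU, hzU⟩ : ∃ c : ℝ, c = |Z i₀ i₀| + |Z i₀ i₂| + |Z i₂ i₀| + |Z i₂ i₂| + 1 := ⟨_, rfl⟩
  obtain ⟨zD, hzD⟩ : ∃ c : ℝ, c = |Z i₁ i₁| + |Z i₁ i₃| + |Z i₃ i₁| + |Z i₃ i₃| + 1 := ⟨_, rfl⟩
  have hcU0 : 0 < cU := by rw [hcU]; positivity
  have hcD0 : 0 < cD := by rw [hcD]; positivity
  have hzU0 : 0 < zU := by rw [hzU]; positivity
  have hzD0 : 0 < zD := by rw [hzD]; positivity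
  refine ⟨(cU + cD + zU + zD) / zetaWeights p, by positivity, fun K hK => ?_⟩
  have hKw : cU + cD + zU + zD ≤ |K - 1| * zetaWeights p := by
    rwa [div_le_iff₀ hwp] at hK
  refine ⟨datumOf_dial_zeta_mem_arithDialSpace p K, ?_, ?_⟩
  · -- detectably negative at the mirror window (offset `0`)
    rcases le_or_gt 0 (K - 1) with hK0 | hK0
    · rw [abs_of_nonneg hK0] at hKw
      have hthr : |Z i₀ i₀| + |Z i₀ i₂| + |Z i₂ i₀| + |Z i₂ i₂| + 1 ≤ (K - 1) * zetaWeights p := by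
        rw [← hzU]; linarith
      refine ⟨win, Pi.single i₀ 1 + Pi.single i₂ 0, ?_⟩
      have h := mirror_plane_neg_up hp2 hwin zetaWeights 0 h02 he₀ he₂ (hZ ▸ hthr) (s := 1) (t := 0)
        (Or.inl one_ne_zero)
      rwa [sub_zero] at h
    · rw [abs_of_neg hK0] at hKw
      have hthr : |Z i₁ i₁| + |Z i₁ i₃| + |Z i₃ i₁| + |Z i₃ i₃| + 1 ≤ (1 - K) * zetaWeights p := by
        rw [← hzD]; linarith
      refine ⟨win, Pi.single i₁ 1 + Pi.single i₃ 0, ?_⟩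
      have h := mirror_plane_neg_down hp2 hwin zetaWeights 0 h13 ho₁ ho₃ (hZ ▸ hthr) (s := 1) (t := 0)
        (Or.inl one_ne_zero)
      rwa [sub_zero] at h
  · -- not in `S`: no hyperplane at the mirror window is positive after subtracting `M₀`
    intro hmem
    obtain ⟨u, hu⟩ := hS hmem win
    rcases le_or_gt 0 (K - 1) with hK0 | hK0
    · rw [abs_of_nonneg hK0] at hKw
      have hthr : |B i₀ i₀| + |B i₀ i₂| + |B i₂ i₀| + |B i₂ i₂| + 1 ≤ (K - 1) * zetaWeights p := by
        rw [← hcU]; linarith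
      obtain ⟨v, hvu, hv⟩ := exists_orth_neg_of_plane_neg
        (evenBlock (dial p K zetaWeights) win - M₀ win) i₀ i₂
        (fun s t hst => mirror_plane_neg_up hp2 hwin zetaWeights (M₀ win) h02 he₀ he₂ (hB ▸ hthr) hst) u
      exact absurd (hu v hvu) (not_le.2 hv)
    · rw [abs_of_neg hK0] at hKw
      have hthr : |B i₁ i₁| + |B i₁ i₃| + |B i₃ i₁| + |B i₃ i₃| + 1 ≤ (1 - K) * zetaWeights p := by
        rw [← hcD]; linarith
      obtain ⟨v, hvu, hv⟩ := exists_orth_neg_of_plane_neg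
        (evenBlock (dial p K zetaWeights) win - M₀ win) i₁ i₃
        (fun s t hst => mirror_plane_neg_down hp2 hwin zetaWeights (M₀ win) h13 ho₁ ho₃ (hB ▸ hthr) hst) u
      exact absurd (hu v hvu) (not_le.2 hv)

/-- PROVED (the same with the mirror window built in): for every prime `p` and every `N ≥ 3`. [folklore] -/
theorem heavyDial_negative_not_mem_of_hyperplanePositive' {S : Set Datum}
    (M₀ : (win : Window) → Matrix (Fin (win.N + 1)) (Fin (win.N + 1)) ℝ)
    (hS : S ⊆ {d | ∀ win : Window, ∃ u : Fin (win.N + 1) → ℝ,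
      ∀ v : Fin (win.N + 1) → ℝ, v ⬝ᵥ u = 0 → 0 ≤ v ⬝ᵥ ((d win - M₀ win) *ᵥ v)})
    {p : ℕ} (hp : p.Prime) {N : ℕ} (hN : 3 ≤ N) :
    ∃ C : ℝ, 0 < C ∧ ∀ K : ℝ, C ≤ |K - 1| →
      datumOf (dial p K zetaWeights) ∈ arithDialSpace ∧ DetectablyNegative (datumOf (dial p K zetaWeights)) ∧
        datumOf (dial p K zetaWeights) ∉ S :=
  heavyDial_negative_not_mem_of_hyperplanePositive M₀ hS hp
    (win := ⟨Real.log p, N, Real.log_pos (by exact_mod_cast hp.one_lt)⟩) rfl hN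

end Summit.RiemannHypothesis.RiemannHypothesis.Theorems.PfPersistence

end
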